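import Mathlib
import Literature.MathematicalPhysics.QuantumFieldTheory.Dimock2011to13.FluctuationCovarianceIdentity
import Literature.MathematicalPhysics.QuantumFieldTheory.Dimock2011to13.BlockAveragingMatrix

/-!
# Dimock, *The renormalization group according to Balaban* I, §4.2 (one): the square root of the fluctuation
# covariance, `C_k^{1/2} = π⁻¹ ∫₀^∞ r^{−1/2} C_{k,r} dr` — PROVED (scalar identity, the operator identity for any
# positive-definite matrix via the spectral theorem, and the positivity of `Δ_k` that makes `C_k` a covariance)

**Citation header (reproduction of PUBLISHED work; template of the Balaban lattice Yang–Mills cell).**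
J. Dimock, *The renormalization group according to Balaban. I. Small fields*, Rev. Math. Phys. **25** (2013) 1330010
(= arXiv:1108.1335v2) [Dimock2013]: §2.2 "free flow" ((norton) L577–580, the minimizer L589–602, (spiffy) L622–637)
and §4.2 (L2051–2052, L2075–2093).  TeX line numbers refer to the arXiv source held by the cell
(`inputs/files/dimock/src/1108.1335/1108.1335.tex`, 4263 lines, sha256[:16] 7382e6540dded9be).  The objects `Gk`,
`Deltak`, `proj`, `Ckr` are those of the sibling leaf `FluctuationCovarianceIdentity` (App. C (lion), same paper).

**What the paper prints (verbatim).**  L577–580 (norton): *"S_k(Φ_k, φ) = (a_k/2)‖Φ_k − Q_kφ‖² + ½⟨φ, (−Δ +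
μ̄_k)φ⟩"*.  L589–602: *"The minimizer satisfies the equation (−Δ + μ̄_k + a_k Q_kᵀQ_k)φ = a_k Q_kᵀΦ_k.  The solution
involves the inverse G_k = (−Δ + μ̄_k + a_k Q_kᵀQ_k)^{−1} and has the form φ = φ_k(Φ_k) defined by φ_k(Φ_k) =
a_k G_k Q_kᵀ Φ_k"*.  L622–637 (spiffy): *"With φ_k = a_kG_kQ_kᵀΦ_k we have S_k(Φ_k, φ_k) = (a_k/2)‖Φ_k‖² −
a_k⟨φ_k, Q_kᵀΦ_k⟩ + ½⟨φ_k, (−Δ + μ̄_k + a_kQ_kᵀQ_k)φ_k⟩ = … = (a_k/2)‖Φ_k‖² − (a_k²/2)⟨Φ_k, Q_kG_kQ_kᵀΦ_k⟩ ≡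
½⟨Φ_k, Δ_kΦ_k⟩ where Δ_k = a_k − a_k²Q_kG_kQ_kᵀ."*  L2051–2052: *"Recall also that C_k = (Δ_k + aL^{−2}QᵀQ)^{−1}
and let μ_{C_k} be the Gaussian measure with covariance C_k."*  L2075–2093: *"We will need a more explicit
representation of C_k^{1/2}.  For λ > 0,  λ^{−1/2} = π^{−1} ∫₀^∞ (dr/√r) (λ + r)^{−1}.  Hence we have the operator
identity.  C_k^{1/2} = π^{−1} ∫₀^∞ (dr/√r) C_{k,r},  C_{k,r} = (Δ_k + (a/L²)QᵀQ + r)^{−1}  (one)"*.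

**What is reproduced here (kernel-checked, zero `sorry`).**  §1 the scalar identity
`integral_rpow_neg_half_mul_inv` : `∫_{r>0} r^{−1/2}(λ + r)⁻¹ dr = π/√λ` for `λ > 0` (substitution `r = u²`, then
Mathlib's `∫₀^∞ (1 + x²)⁻¹ = π/2`), with the integrability of the integrand (`integrableOn_rpow_neg_half_mul_inv`).
§2 the operator identity behind *"Hence"*: for ANY real symmetric positive-definite matrix `M` (spectral theorem,
`Matrix.IsHermitian.spectral_theorem`; the square root is Mathlib's C⋆-algebra square root `CFC.sqrt`, characterised
by `CFC.sqrt_unique`), ENTRYWISE: `sqrt_inv_apply_eq_integral` : `(M⁻¹)^{1/2}_{ij} = π⁻¹ ∫_{r>0} r^{−1/2}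
((M + r)⁻¹)_{ij} dr`.  §3 why `C_k` is a covariance: the printed identity (norton) = (spiffy), `dot_Deltak_mulVec` :
`⟨Φ, Δ_kΦ⟩ = a_k‖Φ − Q_kφ_k‖² + ⟨φ_k, Dφ_k⟩` with `φ_k = a_kG_kQ_kᵀΦ` (`D := −Δ + μ̄_k` any positive-definite
matrix, `Q_k` any matrix, `a_k > 0`), whence `Deltak_posDef` (`Δ_k` is symmetric positive definite) and
`ckInv_posDef` (`C_k⁻¹ = Δ_k + aL·QᵀQ` is positive definite for `aL ≥ 0`).  §4 (one) for the objects of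
`FluctuationCovarianceIdentity`: `sqrt_Ck_apply_eq_integral` : `(C_k^{1/2})_{ij} = π⁻¹ ∫_{r>0} r^{−1/2} (C_{k,r})_{ij} dr`
with `C_k = Ckr D Qk Q ak aL 0` and `C_{k,r} = Ckr D Qk Q ak aL r`.  §5 (v1.1) LEMMA 16 (`\label{11}`, §4.3
L2187–2215), the passage of sup-norm bounds through (one), proof L2197–2206 *"these say |D_{k,r}(y,y′)| ≤ C
e^{−γ₀d(y,y′)} … This gives the L^∞ bound |D_{k,r}W| ≤ C‖W‖_∞.  We also have |A_{k,r}W| ≤ 𝒪(1)(1+r)^{−1}‖W‖_∞.  Hence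
C_{k,r} = A_{k,r} + a_k²A_{k,r}D_{k,r}A_{k,r} satisfies |C_{k,r}W| ≤ C(1+r)^{−1}‖W‖_∞ and so |C_k^{1/2}W| ≤ C‖W‖_∞ ≤
C p_{0,k} as announced"*: `abs_mulVec_le_of_kernel_bound` (the finite Schur test: a kernel dominated by `k(y,y′)` with
row sums `≤ K` is bounded by `K` in sup norm), `abs_add_sq_smul_mulVec_le` (`|(A + a²ADA)W| ≤ c₁(1 + a²c₁δ)(1+r)⁻¹‖W‖_∞`
from `|AW| ≤ c₁(1+r)⁻¹‖W‖_∞`, `|DW| ≤ δ‖W‖_∞`), `sqrt_inv_mulVec_eq_integral` ((one) applied to a vector),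
**`abs_sqrt_inv_mulVec_le`** (for any positive-definite `M`: `|(M + r)⁻¹W| ≤ c(1+r)⁻¹‖W‖_∞` for all `r > 0` ⟹
`|(M⁻¹)^{1/2}W| ≤ c‖W‖_∞`, since `π⁻¹∫₀^∞ r^{−1/2}(1+r)⁻¹dr = 1`) and **`abs_sqrt_Ck_mulVec_le`** (the same for `C_k`,
`C_{k,r}` of `FluctuationCovarianceIdentity`).  §6 (v1.2) the SECOND input from (three): **`abs_Akr_mulVec_le`** (`QᵀQ` a
sup-norm contraction ⟹ `|(A_{k,r}W)_y| ≤ 2max(1, a_k⁻¹)(1+r)⁻¹‖W‖_∞` — *"We also have |A_{k,r}W| ≤ 𝒪(1)(1+r)^{−1}‖W‖_∞"*),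
the assembled bound **`abs_sqrt_Ck_mulVec_le_of_inputs`** (via (two) `Ckr_eq`: `|(C_k^{1/2}W)_i| ≤ c₁(1 + a_k²c₁δ)‖W‖_∞`,
`c₁ = 2max(1, a_k⁻¹)`, from the `QᵀQ`-contraction and the random-walk input `|D_{k,r}W| ≤ δ‖W‖_∞`) and
**`abs_sqrt_Ck_mulVec_le_blockAvg`** (for `Q = BlockAveragingMatrix.Qmat b N`, block averaging with equal fibres, the
`QᵀQ`-contraction and `QQᵀ = I` are theorems — `abs_proj_Qmat_mulVec_le`, `Qmat_mul_transpose` — so the only remaining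
input is App. E's bound on `D_{k,r} = Q_kG_{k,r}Q_kᵀ`).

**Deviations (declared).**  (i) The operator identity is stated entry by entry (real-valued integrals), which avoids
fixing one of Mathlib's non-canonical matrix norms for a Bochner integral of matrices; (ii) `C_k^{1/2}` is Mathlib's
`CFC.sqrt C_k`, the unique positive-semidefinite square root; (iii) abstract finite index types and matrices as in
the sibling leaf (`Δ_k` by its printed closed form (spiffy)); (iv) `aL` stands for `a/L²`, only `aL ≥ 0` is used.

**What is NOT claimed.**  The random-walk INPUT of LEMMA 16 — the estimate `|D_{k,r}(y,y′)| ≤ Ce^{−γ₀d(y,y′)}` of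
App. E, entering §5–§6 as the hypothesis `|D_{k,r}W| ≤ δ‖W‖_∞` (its passage from a pointwise kernel bound is §5's Schur
test; the A_{k,r} input IS proved in §6 for block-averaging `Q`),
the bounds on `𝒲_k`, `∂𝒲_k`, `δ_α∂𝒲_k` ((gk2)) and `𝒲_k ∈ λ_k^{1/4}ℛ_k`; the random-walk expansion of `G_{k,r}`;
the Gaussian-integral bookkeeping (third)/(only); anything of B1–B16 (TEMPLATE.md §4.1 maps (one) to B12 §2 / B9 §E
Thm 3.15 / D4 §3.7–3.8, grade P).  Finite-dimensional linear algebra and one-variable calculus only; `[folklore]`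
items are private helpers.  NOT summit progress; NOT a statement about any Bałaban paper; NOT continuum; NOT Clay.
Unit `b2b-balaban-template` gen 28 (journal CLAIM D1-ONE-SQRT-KERNEL).

**Version.**  v1.2 — ADDITIVE to v1.1 (p205033, commit 3e67aa13c59a): + import `BlockAveragingMatrix` (v1.1, for
`abs_proj_Qmat_mulVec_le`); + §6 `abs_Akr_mulVec_le`, `abs_sqrt_Ck_mulVec_le_of_inputs`, `abs_sqrt_Ck_mulVec_le_blockAvg`
(private `inv_add_le_max_mul_inv`); header bullets §6 and the NOT-claimed line refined; every v1.1 declaration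
byte-identical (unit `b2b-balaban-template` gen 31, journal CLAIM D1-BLOCK-AVERAGE-SUPNORM-KERNEL).  v1.1 — ADDITIVE to
v1.0.1 (p204346, commit 208ed08924d3): + §5 (LEMMA 16's sup-norm passage:
`abs_mulVec_le_of_kernel_bound`, `abs_add_sq_smul_mulVec_le`, `integrableOn_rpow_mul_inv_apply`,
`sqrt_inv_mulVec_eq_integral`, `abs_sqrt_inv_mulVec_le`, `abs_sqrt_Ck_mulVec_le`); header bullets §5 and the NOT-claimed
line refined; every v1.0.1 declaration byte-identical (unit `b2b-balaban-template` gen 31, journal CLAIM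
D1-LEMMA16-SUPNORM-KERNEL).  v1.0.1 — DOCSTRING-ONLY fold (every declaration and proof byte-identical to v1 p196804, commit
81d4da7716e7) of the cross-read XREAD VERDICT journal l.3870 (t4-ne4-p1-g30 on request l.1992: ok CONSISTENT 4∕4, DOCFIX 1
LOW, INFO 3): the TeX locators re-counted against the held source — (norton) L577–580 (v1: L574–576), the minimizer
sentence L589–602 (v1: L586–599), (spiffy) L622–637 (v1: L620–636), «Recall also that C_k = …» L2051–2052 (v1:
L2052–2053), the scalar identity L2083–2086 (v1 tags: L2075–2080); INFO I-1 (the print's middle line of (spiffy), L630,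
omits the `a_k` in `(−Δ + μ̄_k + a_kQ_kᵀQ_k)` — a misprint elided by the «…» of the quotation), I-2, I-3 noted, no
action.  Unit `b2b-balaban-template` gen 31.
-/

namespace Literature.MathematicalPhysics.QuantumFieldTheory.Dimock2011to13.CovarianceSquareRoot

open Matrix MeasureTheory Real Set
open scoped Matrix MatrixOrder
open Literature.MathematicalPhysics.QuantumFieldTheory.Dimock2011to13.FluctuationCovarianceIdentity

/-! ## §1 The scalar identity `λ^{−1/2} = π⁻¹ ∫₀^∞ r^{−1/2} (λ + r)⁻¹ dr` -/

section Scalar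

/-- `∫₀^∞ (λ + u²)⁻¹ du = π/(2√λ)` (scaling of Mathlib's `∫₀^∞ (1 + x²)⁻¹ dx = π/2`). [folklore] -/
private theorem integral_inv_add_sq {l : ℝ} (hl : 0 < l) :
    ∫ u in Ioi (0:ℝ), (l + u ^ 2)⁻¹ = π / (2 * √l) := by
  have hsl : 0 < √l := Real.sqrt_pos.2 hl
  have hb : 0 < (√l)⁻¹ := inv_pos.2 hsl
  have key := integral_comp_mul_left_Ioi (fun x : ℝ => (1 + x ^ 2)⁻¹) 0 hb
  simp only [mul_zero, integral_Ioi_inv_one_add_sq, arctan_zero, sub_zero, inv_inv, smul_eq_mul] at key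
  have hpt : ∀ x : ℝ, (1 + ((√l)⁻¹ * x) ^ 2)⁻¹ = l * (l + x ^ 2)⁻¹ := by
    intro x
    have hl2 : (√l) ^ 2 = l := Real.sq_sqrt hl.le
    field_simp
    rw [hl2]
    ring
  simp_rw [hpt] at key
  rw [integral_const_mul] at key
  have : ∫ u in Ioi (0:ℝ), (l + u ^ 2)⁻¹ = l⁻¹ * (√l * (π / 2)) := by
    rw [← key]; field_simp
  rw [this]
  have hl2 : √l * √l = l := Real.mul_self_sqrt hl.le
  field_simp
  nlinarith [hl2]

/-- *"For λ > 0, λ^{−1/2} = π^{−1} ∫₀^∞ (dr/√r)(λ + r)^{−1}"* — here as `∫_{r>0} r^{−1/2}(λ + r)⁻¹ dr = π/√λ`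
(substitute `r = u²`). [cite: Dimock2013, §4.2 L2083–2086 (arXiv:1108.1335v2 TeX)] -/
theorem integral_rpow_neg_half_mul_inv {l : ℝ} (hl : 0 < l) :
    ∫ r in Ioi (0:ℝ), r ^ (-(1/2:ℝ)) * (l + r)⁻¹ = π / √l := by
  have hsub := integral_comp_rpow_Ioi (fun r : ℝ => r ^ (-(1/2:ℝ)) * (l + r)⁻¹) (p := 2) two_ne_zero
  have hEq : EqOn (fun x : ℝ => (|(2:ℝ)| * x ^ ((2:ℝ) - 1)) • ((x ^ (2:ℝ)) ^ (-(1/2:ℝ)) * (l + x ^ (2:ℝ))⁻¹))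
      (fun x : ℝ => 2 * (l + x ^ 2)⁻¹) (Ioi 0) := by
    intro x hx
    have hx0 : 0 < x := hx
    simp only [smul_eq_mul]
    rw [abs_of_pos (by norm_num : (0:ℝ) < 2), show (2:ℝ) - 1 = 1 by norm_num, Real.rpow_one,
      ← Real.rpow_mul hx0.le, show (2:ℝ) * (-(1/2:ℝ)) = -1 by norm_num, Real.rpow_neg_one,
      show x ^ (2:ℝ) = x ^ (2:ℕ) from Real.rpow_natCast x 2 ▸ by norm_num]
    field_simp
  rw [setIntegral_congr_fun measurableSet_Ioi hEq, integral_const_mul, integral_inv_add_sq hl] at hsub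
  rw [← hsub]
  have hsl : 0 < √l := Real.sqrt_pos.2 hl
  field_simp

/-- The integrand of the printed formula is integrable on `(0, ∞)` (read off from the nonzero value of the
integral). [cite: Dimock2013, §4.2 L2083–2086 (arXiv:1108.1335v2 TeX)] -/
theorem integrableOn_rpow_neg_half_mul_inv {l : ℝ} (hl : 0 < l) :
    IntegrableOn (fun r : ℝ => r ^ (-(1/2:ℝ)) * (l + r)⁻¹) (Ioi 0) := by
  by_contra h
  have h0 := integral_undef h
  rw [integral_rpow_neg_half_mul_inv hl] at h0
  exact absurd h0 (div_pos Real.pi_pos (Real.sqrt_pos.2 hl)).ne'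

end Scalar

/-! ## §2 *"Hence we have the operator identity"*: `(M⁻¹)^{1/2} = π⁻¹ ∫₀^∞ r^{−1/2} (M + r)⁻¹ dr` for a
positive-definite matrix, by the spectral theorem -/

section Spectral

variable {n : Type*} [Fintype n] [DecidableEq n] {M : Matrix n n ℝ}

/-- the orthogonal matrix of eigenvectors (Mathlib's `eigenvectorUnitary`). [folklore] -/
private noncomputable def eigU (hM : M.PosDef) : Matrix n n ℝ := (hM.1.eigenvectorUnitary : Matrix n n ℝ)

/-- the eigenvalues. [folklore] -/
private noncomputable def eig (hM : M.PosDef) : n → ℝ := hM.1.eigenvalues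

/-- spectral multiplier `E(g) = U diag(g) U*`. [folklore] -/
private noncomputable def specMul (hM : M.PosDef) (g : n → ℝ) : Matrix n n ℝ :=
  eigU hM * diagonal g * star (eigU hM)

/-- `U*U = 1`. [folklore] -/
private theorem star_eigU_mul (hM : M.PosDef) : star (eigU hM) * eigU hM = 1 := Unitary.coe_star_mul_self hM.1.eigenvectorUnitary

/-- `UU* = 1`. [folklore] -/
private theorem eigU_mul_star (hM : M.PosDef) : eigU hM * star (eigU hM) = 1 := Unitary.coe_mul_star_self hM.1.eigenvectorUnitary

/-- the eigenvalues of a positive-definite matrix are positive (Mathlib). [folklore] -/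
private theorem eig_pos (hM : M.PosDef) (k : n) : 0 < eig hM k := hM.eigenvalues_pos k

/-- `E(1) = 1`. [folklore] -/
private theorem specMul_one (hM : M.PosDef) : specMul hM 1 = 1 := by
  unfold specMul
  rw [show diagonal (1 : n → ℝ) = 1 from diagonal_one, Matrix.mul_one, eigU_mul_star]

/-- `E(g)E(h) = E(gh)`. [folklore] -/
private theorem specMul_mul (hM : M.PosDef) (g h : n → ℝ) : specMul hM g * specMul hM h = specMul hM (g * h) := by
  unfold specMul
  calc eigU hM * diagonal g * star (eigU hM) * (eigU hM * diagonal h * star (eigU hM))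
      = eigU hM * diagonal g * (star (eigU hM) * eigU hM) * diagonal h * star (eigU hM) := by
        simp only [Matrix.mul_assoc]
    _ = eigU hM * diagonal (g * h) * star (eigU hM) := by
        rw [star_eigU_mul, Matrix.mul_one, Matrix.mul_assoc (eigU hM) (diagonal g), diagonal_mul_diagonal]
        rfl

/-- `E` is additive. [folklore] -/
private theorem specMul_add (hM : M.PosDef) (g h : n → ℝ) : specMul hM (g + h) = specMul hM g + specMul hM h := by
  unfold specMul
  have hd : diagonal (g + h) = diagonal g + diagonal h := by rw [diagonal_add]; rfl
  rw [hd, Matrix.mul_add, Matrix.add_mul]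

/-- `E` is homogeneous. [folklore] -/
private theorem specMul_smul (hM : M.PosDef) (c : ℝ) (g : n → ℝ) : specMul hM (c • g) = c • specMul hM g := by
  unfold specMul
  rw [diagonal_smul, Matrix.mul_smul, Matrix.smul_mul]

/-- `E(c) = c·1`. [folklore] -/
private theorem specMul_const (hM : M.PosDef) (c : ℝ) : specMul hM (fun _ => c) = c • (1 : Matrix n n ℝ) := by
  have : (fun _ : n => c) = c • (1 : n → ℝ) := by ext k; simp
  rw [this, specMul_smul, specMul_one]

/-- the spectral theorem: `M = U diag(λ) U*`. [folklore] -/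
private theorem eq_specMul_eig (hM : M.PosDef) : M = specMul hM (eig hM) := by
  have h := hM.1.spectral_theorem
  rw [Unitary.conjStarAlgAut_apply] at h
  simpa [specMul, eigU, eig] using h

/-- entries of `E(g)`. [folklore] -/
private theorem specMul_apply (hM : M.PosDef) (g : n → ℝ) (i j : n) :
    specMul hM g i j = ∑ k, eigU hM i k * g k * eigU hM j k := by
  unfold specMul
  rw [Matrix.mul_apply]
  refine Finset.sum_congr rfl fun k _ => ?_
  rw [mul_diagonal, Matrix.star_apply, star_trivial]

/-- the resolvent: `(M + r)⁻¹ = U diag((λ_k + r)⁻¹) U*` for `r ≥ 0`. [folklore] -/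
private theorem inv_add_smul_one_eq (hM : M.PosDef) {r : ℝ} (hr : 0 ≤ r) :
    (M + r • (1 : Matrix n n ℝ))⁻¹ = specMul hM (fun k => (eig hM k + r)⁻¹) := by
  have hsum : M + r • (1 : Matrix n n ℝ) = specMul hM (fun k => eig hM k + r) := by
    have : (fun k => eig hM k + r) = eig hM + fun _ => r := by ext k; simp
    rw [this, specMul_add, specMul_const, ← eq_specMul_eig hM]
  apply Matrix.inv_eq_right_inv
  rw [hsum, specMul_mul]
  have : ((fun k => eig hM k + r) * fun k => (eig hM k + r)⁻¹) = 1 := by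
    ext k
    simp only [Pi.mul_apply, Pi.one_apply]
    exact mul_inv_cancel₀ (by have := eig_pos hM k; linarith)
  rw [this, specMul_one]

/-- `E(g) ≥ 0` for `g ≥ 0`. [folklore] -/
private theorem specMul_posSemidef (hM : M.PosDef) {g : n → ℝ} (hg : ∀ k, 0 ≤ g k) : (specMul hM g).PosSemidef := by
  unfold specMul
  have hD : (diagonal g).PosSemidef := PosSemidef.diagonal fun k => hg k
  have h := hD.mul_mul_conjTranspose_same (eigU hM)
  rwa [← Matrix.star_eq_conjTranspose] at h

/-- `(M⁻¹)^{1/2} = U diag(λ_k^{−1/2}) U*` (Mathlib's `CFC.sqrt`, by uniqueness of the positive square root).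
[folklore] -/
private theorem sqrt_inv_eq_specMul (hM : M.PosDef) : CFC.sqrt M⁻¹ = specMul hM (fun k => (√(eig hM k))⁻¹) := by
  have hinv : M⁻¹ = specMul hM (fun k => (eig hM k)⁻¹) := by
    have h := inv_add_smul_one_eq hM le_rfl
    simpa using h
  apply CFC.sqrt_unique
  · rw [specMul_mul, hinv]
    congr 1
    ext k
    simp only [Pi.mul_apply]
    rw [← mul_inv, Real.mul_self_sqrt (eig_pos hM k).le]
  · exact (specMul_posSemidef hM fun k => inv_nonneg.2 (Real.sqrt_nonneg _)).nonneg

/-- *"Hence we have the operator identity"* — for ANY real symmetric positive-definite matrix `M` (in [Dimock2013]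
`M = C_k⁻¹ = Δ_k + aL^{−2}QᵀQ`), entrywise: `((M⁻¹)^{1/2})_{ij} = π⁻¹ ∫_{r>0} r^{−1/2} ((M + r)⁻¹)_{ij} dr`, the
square root being Mathlib's `CFC.sqrt`. [cite: Dimock2013, §4.2 (one) L2075–2093 (arXiv:1108.1335v2 TeX)] -/
theorem sqrt_inv_apply_eq_integral (hM : M.PosDef) (i j : n) :
    (CFC.sqrt M⁻¹) i j = π⁻¹ * ∫ r in Ioi (0:ℝ), r ^ (-(1/2:ℝ)) * (M + r • (1 : Matrix n n ℝ))⁻¹ i j := by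
  have hEq : EqOn (fun r : ℝ => r ^ (-(1/2:ℝ)) * (M + r • (1 : Matrix n n ℝ))⁻¹ i j)
      (fun r : ℝ => ∑ k, (eigU hM i k * eigU hM j k) * (r ^ (-(1/2:ℝ)) * (eig hM k + r)⁻¹)) (Ioi 0) := by
    intro r hr
    have hr0 : 0 ≤ r := le_of_lt hr
    simp only
    rw [inv_add_smul_one_eq hM hr0, specMul_apply, Finset.mul_sum]
    refine Finset.sum_congr rfl fun k _ => ?_
    ring
  rw [setIntegral_congr_fun measurableSet_Ioi hEq, integral_finsetSum]
  · rw [sqrt_inv_eq_specMul hM, specMul_apply, Finset.mul_sum]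
    refine Finset.sum_congr rfl fun k _ => ?_
    rw [integral_const_mul, integral_rpow_neg_half_mul_inv (eig_pos hM k)]
    have hsk : 0 < √(eig hM k) := Real.sqrt_pos.2 (eig_pos hM k)
    field_simp
  · intro k _
    exact (integrableOn_rpow_neg_half_mul_inv (eig_pos hM k)).const_mul _

end Spectral

/-! ## §3 `Δ_k` is positive definite: the identity (norton) = (spiffy), so `C_k` IS a covariance -/

section Deltak

variable {ι κ σ : Type*} [Fintype ι] [Fintype κ] [Fintype σ] [DecidableEq ι] [DecidableEq κ] [DecidableEq σ]
variable {D : Matrix κ κ ℝ} {Qk : Matrix ι κ ℝ} {ak aL : ℝ}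

omit [DecidableEq ι] in
/-- `G_k` is a right inverse of its bracket `D + a_k Q_kᵀQ_k` (the bracket is positive definite). [folklore] -/
private theorem gkInv_mul_Gk (hD : D.PosDef) (hak : 0 < ak) : (D + ak • (Qkᵀ * Qk)) * Gk D Qk ak = 1 := by
  unfold Gk
  exact Matrix.mul_nonsing_inv _ ((Matrix.isUnit_iff_isUnit_det _).1 (gkInv_posDef (Qk := Qk) hD hak).isUnit)

/-- (norton) evaluated at the minimizer equals (spiffy): with `φ_k = a_k G_k Q_kᵀ Φ`,
`⟨Φ, Δ_kΦ⟩ = a_k‖Φ − Q_kφ_k‖² + ⟨φ_k, Dφ_k⟩` (`= 2S_k(Φ, φ_k)`; `D := −Δ + μ̄_k`). [cite: Dimock2013, §2.2 (norton)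
L577–580, L589–602, (spiffy) L622–637 (arXiv:1108.1335v2 TeX)] -/
theorem dot_Deltak_mulVec (hD : D.PosDef) (hak : 0 < ak) (Φ : ι → ℝ) :
    Φ ⬝ᵥ (Deltak D Qk ak *ᵥ Φ)
      = ak * ((Φ - Qk *ᵥ (ak • (Gk D Qk ak *ᵥ (Qkᵀ *ᵥ Φ)))) ⬝ᵥ (Φ - Qk *ᵥ (ak • (Gk D Qk ak *ᵥ (Qkᵀ *ᵥ Φ)))))
        + (ak • (Gk D Qk ak *ᵥ (Qkᵀ *ᵥ Φ))) ⬝ᵥ (D *ᵥ (ak • (Gk D Qk ak *ᵥ (Qkᵀ *ᵥ Φ)))) := by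
  set g : κ → ℝ := Gk D Qk ak *ᵥ (Qkᵀ *ᵥ Φ) with hg
  set s1 : ℝ := Φ ⬝ᵥ Φ with hs1
  set s2 : ℝ := Φ ⬝ᵥ (Qk *ᵥ g) with hs2
  set s3 : ℝ := (Qk *ᵥ g) ⬝ᵥ (Qk *ᵥ g) with hs3
  set s4 : ℝ := g ⬝ᵥ (D *ᵥ g) with hs4
  -- the minimizer equation `(D + a_k Q_kᵀQ_k) g = Q_kᵀ Φ` (L589–602, divided by `a_k`), paired with `g`
  have hAg : (D + ak • (Qkᵀ * Qk)) *ᵥ g = Qkᵀ *ᵥ Φ := by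
    rw [hg, mulVec_mulVec, gkInv_mul_Gk hD hak, one_mulVec]
  have hiv : s4 = s2 - ak * s3 := by
    have h1 : g ⬝ᵥ ((D + ak • (Qkᵀ * Qk)) *ᵥ g) = s4 + ak * s3 := by
      rw [add_mulVec, dotProduct_add, smul_mulVec, dotProduct_smul, ← mulVec_mulVec, dotProduct_mulVec g Qkᵀ,
        vecMul_transpose, smul_eq_mul]
    have h2 : g ⬝ᵥ ((D + ak • (Qkᵀ * Qk)) *ᵥ g) = s2 := by
      rw [hAg, dotProduct_mulVec, vecMul_transpose, dotProduct_comm]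
    linarith
  -- the left side, from the closed form (spiffy) `Δ_k = a_k − a_k² Q_k G_k Q_kᵀ`
  have hL : Φ ⬝ᵥ (Deltak D Qk ak *ᵥ Φ) = ak * s1 - ak ^ 2 * s2 := by
    unfold Deltak
    rw [sub_mulVec, dotProduct_sub, smul_mulVec, one_mulVec, dotProduct_smul, smul_mulVec, dotProduct_smul,
      ← mulVec_mulVec, ← mulVec_mulVec, smul_eq_mul, smul_eq_mul]
  -- the square `‖Φ − Q_k φ_k‖²`
  have hsq : (Φ - Qk *ᵥ (ak • g)) ⬝ᵥ (Φ - Qk *ᵥ (ak • g)) = s1 - 2 * ak * s2 + ak ^ 2 * s3 := by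
    rw [mulVec_smul, sub_dotProduct, dotProduct_sub, dotProduct_sub, dotProduct_smul, smul_dotProduct, smul_dotProduct,
      dotProduct_smul, dotProduct_comm (Qk *ᵥ g) Φ]
    simp only [smul_eq_mul]
    ring
  -- the `D` term `⟨φ_k, Dφ_k⟩`
  have hD' : (ak • g) ⬝ᵥ (D *ᵥ (ak • g)) = ak ^ 2 * s4 := by
    rw [mulVec_smul, smul_dotProduct, dotProduct_smul, smul_eq_mul, smul_eq_mul]
    ring
  rw [hL, hsq, hD']
  linear_combination (-(ak ^ 2)) * hiv

/-- `Δ_k = a_k − a_k²Q_kG_kQ_kᵀ` is symmetric (`D` symmetric). [cite: Dimock2013, §2.2 (spiffy) L622–637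
(arXiv:1108.1335v2 TeX)] -/
theorem Deltak_isHermitian (hD : D.PosDef) (ak : ℝ) : (Deltak D Qk ak).IsHermitian := by
  unfold Deltak Gk
  have hA : (D + ak • (Qkᵀ * Qk)).IsHermitian := by
    refine hD.1.add ?_
    have h := isHermitian_conjTranspose_mul_self Qk
    rw [conjTranspose_eq_transpose_of_trivial] at h
    exact h.smul (isSelfAdjoint_iff.2 (star_trivial ak))
  refine (isHermitian_one.smul (isSelfAdjoint_iff.2 (star_trivial ak))).sub ?_
  have h := isHermitian_mul_mul_conjTranspose Qk hA.inv
  rw [conjTranspose_eq_transpose_of_trivial] at h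
  exact h.smul (isSelfAdjoint_iff.2 (star_trivial _))

/-- `Δ_k` is positive definite for `D = −Δ + μ̄_k` positive definite and `a_k > 0`: by `dot_Deltak_mulVec`,
`⟨Φ, Δ_kΦ⟩ = 2S_k(Φ, φ_k) ≥ 0` with equality only if `φ_k = 0` and then `Φ = 0` — the positivity presupposed by
*"ρ_k(Φ_k) = Z_k exp(−S_k(Φ_k, φ_k))"* (only) and by *"the Gaussian measure with covariance C_k"*.
[cite: Dimock2013, §2.2 (spiffy) L622–637 and §4.2 L2051–2052 (arXiv:1108.1335v2 TeX)] -/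
theorem Deltak_posDef (hD : D.PosDef) (hak : 0 < ak) : (Deltak D Qk ak).PosDef := by
  refine PosDef.of_dotProduct_mulVec_pos (Deltak_isHermitian hD ak) fun x hx => ?_
  rw [star_trivial, dot_Deltak_mulVec hD hak]
  set φ : κ → ℝ := ak • (Gk D Qk ak *ᵥ (Qkᵀ *ᵥ x))
  have h1 : 0 ≤ (x - Qk *ᵥ φ) ⬝ᵥ (x - Qk *ᵥ φ) := Finset.sum_nonneg fun i _ => mul_self_nonneg _
  have h2 : 0 ≤ φ ⬝ᵥ (D *ᵥ φ) := by
    have := hD.posSemidef.dotProduct_mulVec_nonneg φ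
    rwa [star_trivial] at this
  by_contra hneg
  push Not at hneg
  have h2' : φ ⬝ᵥ (D *ᵥ φ) = 0 := by nlinarith [mul_nonneg hak.le h1]
  have hφ : φ = 0 := by
    by_contra hφ
    have := hD.dotProduct_mulVec_pos hφ
    rw [star_trivial] at this
    linarith
  have h1' : (x - Qk *ᵥ φ) ⬝ᵥ (x - Qk *ᵥ φ) = 0 := by nlinarith [mul_nonneg hak.le h1]
  rw [hφ, mulVec_zero, sub_zero, dotProduct_self_eq_zero] at h1'
  exact hx h1'

omit [DecidableEq σ] in
/-- `C_k⁻¹ = Δ_k + aL^{−2}QᵀQ` is positive definite (`aL ≥ 0`), so *"the Gaussian measure with covariance C_k"*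
exists. [cite: Dimock2013, §4.2 L2051–2052 (arXiv:1108.1335v2 TeX)] -/
theorem ckInv_posDef (hD : D.PosDef) (hak : 0 < ak) (haL : 0 ≤ aL) (Q : Matrix σ ι ℝ) :
    (Deltak D Qk ak + aL • proj Q).PosDef := by
  classical
  refine (Deltak_posDef hD hak).add_posSemidef ?_
  have h := Matrix.posSemidef_conjTranspose_mul_self Q
  rw [conjTranspose_eq_transpose_of_trivial] at h
  exact h.smul haL

end Deltak

/-! ## §4 (one) for `C_k = (Δ_k + aL^{−2}QᵀQ)^{−1}` and `C_{k,r}` of `FluctuationCovarianceIdentity` -/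

section One

variable {ι κ σ : Type*} [Fintype ι] [Fintype κ] [Fintype σ] [DecidableEq ι] [DecidableEq κ] [DecidableEq σ]
variable {D : Matrix κ κ ℝ} {Qk : Matrix ι κ ℝ} {Q : Matrix σ ι ℝ} {ak aL : ℝ}

omit [DecidableEq σ] in
/-- `C_k = C_{k,0}` and `C_{k,r} = (C_k⁻¹ + r)^{−1}` (definitional bookkeeping). [cite: Dimock2013, §4.2 L2051–2052 and
(one) L2087–2093 (arXiv:1108.1335v2 TeX)] -/
theorem Ckr_eq_inv_add (r : ℝ) :
    Ckr D Qk Q ak aL r = ((Deltak D Qk ak + aL • proj Q) + r • (1 : Matrix ι ι ℝ))⁻¹ := rfl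

omit [DecidableEq σ] in
/-- **(one)** `C_k^{1/2} = π^{−1} ∫₀^∞ (dr/√r) C_{k,r}`, entrywise, for `D = −Δ + μ̄_k` positive definite, `a_k > 0`,
`aL = a/L² ≥ 0`, any `Q_k`, `Q`: `(C_k^{1/2})_{ij} = π⁻¹ ∫_{r>0} r^{−1/2} (C_{k,r})_{ij} dr` with `C_k = Ckr … 0` and
`C_k^{1/2}` Mathlib's `CFC.sqrt`. [cite: Dimock2013, §4.2 (one) L2075–2093 (arXiv:1108.1335v2 TeX)] -/
theorem sqrt_Ck_apply_eq_integral (hD : D.PosDef) (hak : 0 < ak) (haL : 0 ≤ aL) (i j : ι) :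
    (CFC.sqrt (Ckr D Qk Q ak aL 0)) i j
      = π⁻¹ * ∫ r in Ioi (0:ℝ), r ^ (-(1/2:ℝ)) * (Ckr D Qk Q ak aL r) i j := by
  have hM := ckInv_posDef (Qk := Qk) hD hak haL Q
  have h0 : Ckr D Qk Q ak aL 0 = (Deltak D Qk ak + aL • proj Q)⁻¹ := by
    rw [Ckr_eq_inv_add, zero_smul, add_zero]
  rw [h0, sqrt_inv_apply_eq_integral hM i j]
  rfl

end One

/-! ## §5 (v1.1) LEMMA 16 (`\label{11}`): sup-norm bounds pass through the square-root formula (one) -/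

section SupNorm

/-- **the finite Schur test** behind *"This gives the L^∞ bound |D_{k,r}W| ≤ C‖W‖_∞"*: a kernel dominated entrywise
by `k(y,y′)` whose row sums are `≤ K` maps `W` to a vector with entries `≤ K‖W‖_∞` (with `k = Ce^{−γ₀d(y,y′)}` the row
sum is the one-link sum of `RandomWalkTorusDecay.sum_exp_torusDist_le` on the cell's torus). [cite: Dimock2013, §4.3
Lemma 11 proof L2199–2203 (arXiv:1108.1335v2 TeX)] -/
theorem abs_mulVec_le_of_kernel_bound {m : Type*} [Fintype m] (D k : Matrix m m ℝ) {K : ℝ}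
    (hk : ∀ y y', |D y y'| ≤ k y y') (hK : ∀ y, ∑ y', k y y' ≤ K) (W : m → ℝ) (y : m) :
    |(D *ᵥ W) y| ≤ K * ‖W‖ := by
  have hW : ∀ y', |W y'| ≤ ‖W‖ := fun y' => by
    simpa [Real.norm_eq_abs] using norm_le_pi_norm W y'
  calc |(D *ᵥ W) y| = |∑ y', D y y' * W y'| := rfl
    _ ≤ ∑ y', |D y y' * W y'| := Finset.abs_sum_le_sum_abs _ _
    _ ≤ ∑ y', k y y' * ‖W‖ := Finset.sum_le_sum fun y' _ => by
        rw [abs_mul]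
        exact mul_le_mul (hk y y') (hW y') (abs_nonneg _) ((abs_nonneg _).trans (hk y y'))
    _ = (∑ y', k y y') * ‖W‖ := by rw [Finset.sum_mul]
    _ ≤ K * ‖W‖ := mul_le_mul_of_nonneg_right (hK y) (norm_nonneg _)

/-- from entrywise bounds to the sup norm of the image. [folklore] -/
private theorem norm_mulVec_le_of_abs_le {m : Type*} [Fintype m] (A : Matrix m m ℝ) {a : ℝ} (ha : 0 ≤ a)
    (hA : ∀ (W : m → ℝ) (y : m), |(A *ᵥ W) y| ≤ a * ‖W‖) (W : m → ℝ) : ‖A *ᵥ W‖ ≤ a * ‖W‖ :=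
  (pi_norm_le_iff_of_nonneg (mul_nonneg ha (norm_nonneg _))).2 fun y => by
    rw [Real.norm_eq_abs]; exact hA W y

/-- *"Hence C_{k,r} = A_{k,r} + a_k²A_{k,r}D_{k,r}A_{k,r} satisfies |C_{k,r}W| ≤ C(1+r)^{−1}‖W‖_∞"*: sup-norm bounds
compose — `|AW| ≤ c₁(1+r)⁻¹‖W‖_∞` and `|DW| ≤ δ‖W‖_∞` give `|(A + a²ADA)W| ≤ c₁(1 + a²c₁δ)(1+r)⁻¹‖W‖_∞` for `r ≥ 0`.
[cite: Dimock2013, §4.3 Lemma 11 proof L2203–2206 (arXiv:1108.1335v2 TeX)] -/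
theorem abs_add_sq_smul_mulVec_le {m : Type*} [Fintype m] (A D : Matrix m m ℝ) {a c₁ δ r : ℝ} (hc₁ : 0 ≤ c₁)
    (hδ : 0 ≤ δ) (hr : 0 ≤ r) (hA : ∀ (W : m → ℝ) (y : m), |(A *ᵥ W) y| ≤ c₁ * (1 + r)⁻¹ * ‖W‖)
    (hD : ∀ (W : m → ℝ) (y : m), |(D *ᵥ W) y| ≤ δ * ‖W‖) (W : m → ℝ) (y : m) :
    |((A + a ^ 2 • (A * D * A)) *ᵥ W) y| ≤ c₁ * (1 + a ^ 2 * c₁ * δ) * (1 + r)⁻¹ * ‖W‖ := by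
  have h1r : 0 < 1 + r := by linarith
  have hα : 0 ≤ c₁ * (1 + r)⁻¹ := mul_nonneg hc₁ (inv_nonneg.2 h1r.le)
  have hAn := norm_mulVec_le_of_abs_le A hα hA
  have hDn := norm_mulVec_le_of_abs_le D hδ hD
  have hADA : |((A * D * A) *ᵥ W) y| ≤ c₁ * (1 + r)⁻¹ * (δ * (c₁ * (1 + r)⁻¹ * ‖W‖)) := by
    rw [← Matrix.mulVec_mulVec, ← Matrix.mulVec_mulVec]
    refine (hA _ y).trans (mul_le_mul_of_nonneg_left ?_ hα)
    exact (hDn _).trans (mul_le_mul_of_nonneg_left (hAn W) hδ)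
  have hinv1 : (1 + r)⁻¹ ≤ 1 := inv_le_one_of_one_le₀ (by linarith)
  rw [Matrix.add_mulVec, Matrix.smul_mulVec, Pi.add_apply, Pi.smul_apply, smul_eq_mul]
  calc |(A *ᵥ W) y + a ^ 2 * ((A * D * A) *ᵥ W) y|
      ≤ |(A *ᵥ W) y| + |a ^ 2 * ((A * D * A) *ᵥ W) y| := abs_add_le _ _
    _ ≤ c₁ * (1 + r)⁻¹ * ‖W‖ + a ^ 2 * (c₁ * (1 + r)⁻¹ * (δ * (c₁ * (1 + r)⁻¹ * ‖W‖))) := by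
        rw [abs_mul, abs_of_nonneg (sq_nonneg a)]
        exact add_le_add (hA W y) (mul_le_mul_of_nonneg_left hADA (sq_nonneg a))
    _ = c₁ * (1 + r)⁻¹ * ‖W‖ * (1 + a ^ 2 * c₁ * δ * (1 + r)⁻¹) := by ring
    _ ≤ c₁ * (1 + r)⁻¹ * ‖W‖ * (1 + a ^ 2 * c₁ * δ * 1) := by
        refine mul_le_mul_of_nonneg_left ?_ (mul_nonneg hα (norm_nonneg _))
        have h := mul_le_mul_of_nonneg_left hinv1 (mul_nonneg (mul_nonneg (sq_nonneg a) hc₁) hδ)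
        linarith
    _ = c₁ * (1 + a ^ 2 * c₁ * δ) * (1 + r)⁻¹ * ‖W‖ := by ring

variable {n : Type*} [Fintype n] [DecidableEq n] {M : Matrix n n ℝ}

/-- the entries of the integrand of (one) are integrable on `(0, ∞)` (spectral representation). [cite: Dimock2013,
§4.2 (one) L2083–2093 (arXiv:1108.1335v2 TeX)] -/
theorem integrableOn_rpow_mul_inv_apply (hM : M.PosDef) (i j : n) :
    IntegrableOn (fun r : ℝ => r ^ (-(1/2:ℝ)) * (M + r • (1 : Matrix n n ℝ))⁻¹ i j) (Ioi 0) := by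
  have hEq : EqOn (fun r : ℝ => ∑ k, (eigU hM i k * eigU hM j k) * (r ^ (-(1/2:ℝ)) * (eig hM k + r)⁻¹))
      (fun r : ℝ => r ^ (-(1/2:ℝ)) * (M + r • (1 : Matrix n n ℝ))⁻¹ i j) (Ioi 0) := by
    intro r hr
    have hr0 : 0 ≤ r := le_of_lt hr
    simp only
    rw [inv_add_smul_one_eq hM hr0, specMul_apply, Finset.mul_sum]
    refine Finset.sum_congr rfl fun k _ => ?_
    ring
  refine IntegrableOn.congr_fun ?_ hEq measurableSet_Ioi
  exact integrable_finsetSum _ fun k _ => (integrableOn_rpow_neg_half_mul_inv (eig_pos hM k)).const_mul _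

/-- (one) applied to a vector: `((M⁻¹)^{1/2}W)_i = π⁻¹ ∫_{r>0} r^{−1/2} ((M + r)⁻¹W)_i dr`. [cite: Dimock2013, §4.2
(one) L2083–2093 and §4.3 Lemma 11 proof L2197–2198 (arXiv:1108.1335v2 TeX)] -/
theorem sqrt_inv_mulVec_eq_integral (hM : M.PosDef) (W : n → ℝ) (i : n) :
    (CFC.sqrt M⁻¹ *ᵥ W) i
      = π⁻¹ * ∫ r in Ioi (0:ℝ), r ^ (-(1/2:ℝ)) * ((M + r • (1 : Matrix n n ℝ))⁻¹ *ᵥ W) i := by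
  have hfun : (fun r : ℝ => r ^ (-(1/2:ℝ)) * ((M + r • (1 : Matrix n n ℝ))⁻¹ *ᵥ W) i)
      = fun r : ℝ => ∑ j, (r ^ (-(1/2:ℝ)) * (M + r • (1 : Matrix n n ℝ))⁻¹ i j) * W j := by
    funext r
    simp only [Matrix.mulVec, dotProduct, Finset.mul_sum]
    refine Finset.sum_congr rfl fun j _ => ?_
    ring
  rw [hfun, integral_finsetSum _ fun j _ => (integrableOn_rpow_mul_inv_apply hM i j).mul_const _,
    Finset.mul_sum]
  simp only [Matrix.mulVec, dotProduct]
  refine Finset.sum_congr rfl fun j _ => ?_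
  rw [integral_mul_const, sqrt_inv_apply_eq_integral hM i j]
  ring

/-- **LEMMA 16's passage** *"|C_{k,r}W| ≤ C(1+r)^{−1}‖W‖_∞ and so |C_k^{1/2}W| ≤ C‖W‖_∞"* — for ANY real symmetric
positive-definite `M`: if `|((M + r)⁻¹W)_i| ≤ c(1+r)⁻¹‖W‖_∞` for all `r > 0`, all `W`, all `i`, then
`|((M⁻¹)^{1/2}W)_i| ≤ c‖W‖_∞` (the constant passes unchanged because `π⁻¹∫₀^∞ r^{−1/2}(1+r)⁻¹dr = 1`, §1 at `λ = 1`).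
[cite: Dimock2013, §4.3 Lemma 11 L2187–2191 with proof L2197–2206 (arXiv:1108.1335v2 TeX)] -/
theorem abs_sqrt_inv_mulVec_le (hM : M.PosDef) {c : ℝ}
    (hc : ∀ r : ℝ, 0 < r → ∀ (W : n → ℝ) (i : n),
      |((M + r • (1 : Matrix n n ℝ))⁻¹ *ᵥ W) i| ≤ c * (1 + r)⁻¹ * ‖W‖)
    (W : n → ℝ) (i : n) : |(CFC.sqrt M⁻¹ *ᵥ W) i| ≤ c * ‖W‖ := by
  rw [sqrt_inv_mulVec_eq_integral hM W i, abs_mul, abs_inv, abs_of_pos Real.pi_pos]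
  have hint : IntegrableOn (fun r : ℝ => r ^ (-(1/2:ℝ)) * ((M + r • (1 : Matrix n n ℝ))⁻¹ *ᵥ W) i)
      (Ioi 0) := by
    have hfun : (fun r : ℝ => r ^ (-(1/2:ℝ)) * ((M + r • (1 : Matrix n n ℝ))⁻¹ *ᵥ W) i)
        = fun r : ℝ => ∑ j, (r ^ (-(1/2:ℝ)) * (M + r • (1 : Matrix n n ℝ))⁻¹ i j) * W j := by
      funext r
      simp only [Matrix.mulVec, dotProduct, Finset.mul_sum]
      refine Finset.sum_congr rfl fun j _ => ?_
      ring
    rw [hfun]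
    exact integrable_finsetSum _ fun j _ => (integrableOn_rpow_mul_inv_apply hM i j).mul_const _
  have hbound : ∀ r ∈ Ioi (0:ℝ),
      |r ^ (-(1/2:ℝ)) * ((M + r • (1 : Matrix n n ℝ))⁻¹ *ᵥ W) i|
        ≤ c * ‖W‖ * (r ^ (-(1/2:ℝ)) * (1 + r)⁻¹) := by
    intro r hr
    have hr0 : 0 < r := hr
    have hrp : 0 ≤ r ^ (-(1/2:ℝ)) := Real.rpow_nonneg hr0.le _
    rw [abs_mul, abs_of_nonneg hrp]
    calc r ^ (-(1/2:ℝ)) * |((M + r • (1 : Matrix n n ℝ))⁻¹ *ᵥ W) i|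
        ≤ r ^ (-(1/2:ℝ)) * (c * (1 + r)⁻¹ * ‖W‖) := mul_le_mul_of_nonneg_left (hc r hr0 W i) hrp
      _ = c * ‖W‖ * (r ^ (-(1/2:ℝ)) * (1 + r)⁻¹) := by ring
  have h1 : |∫ r in Ioi (0:ℝ), r ^ (-(1/2:ℝ)) * ((M + r • (1 : Matrix n n ℝ))⁻¹ *ᵥ W) i|
      ≤ ∫ r in Ioi (0:ℝ), c * ‖W‖ * (r ^ (-(1/2:ℝ)) * (1 + r)⁻¹) := by
    refine abs_integral_le_integral_abs.trans ?_
    exact setIntegral_mono_on hint.abs ((integrableOn_rpow_neg_half_mul_inv one_pos).const_mul _)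
      measurableSet_Ioi hbound
  rw [integral_const_mul, integral_rpow_neg_half_mul_inv one_pos, Real.sqrt_one, div_one] at h1
  calc π⁻¹ * |∫ r in Ioi (0:ℝ), r ^ (-(1/2:ℝ)) * ((M + r • (1 : Matrix n n ℝ))⁻¹ *ᵥ W) i|
      ≤ π⁻¹ * (c * ‖W‖ * π) := mul_le_mul_of_nonneg_left h1 (inv_nonneg.2 Real.pi_pos.le)
    _ = c * ‖W‖ := by field_simp

variable {ι κ σ : Type*} [Fintype ι] [Fintype κ] [Fintype σ] [DecidableEq ι] [DecidableEq κ] [DecidableEq σ]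
variable {D : Matrix κ κ ℝ} {Qk : Matrix ι κ ℝ} {Q : Matrix σ ι ℝ} {ak aL : ℝ}

omit [DecidableEq σ] in
/-- **LEMMA 16 for `C_k`**: *"|C_{k,r}W| ≤ C(1+r)^{−1}‖W‖_∞ and so |C_k^{1/2}W| ≤ C‖W‖_∞ … as announced"* — with
`C_k = Ckr D Qk Q ak aL 0`, `C_{k,r} = Ckr D Qk Q ak aL r` of `FluctuationCovarianceIdentity` (`D = −Δ + μ̄_k` positive
definite, `a_k > 0`, `aL = a/L² ≥ 0`): the sup-norm bound of the resolvents passes to `C_k^{1/2} = CFC.sqrt C_k`.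
[cite: Dimock2013, §4.3 Lemma 11 L2187–2191 with proof L2197–2206 (arXiv:1108.1335v2 TeX)] -/
theorem abs_sqrt_Ck_mulVec_le (hD : D.PosDef) (hak : 0 < ak) (haL : 0 ≤ aL) {c : ℝ}
    (hc : ∀ r : ℝ, 0 < r → ∀ (W : ι → ℝ) (i : ι), |(Ckr D Qk Q ak aL r *ᵥ W) i| ≤ c * (1 + r)⁻¹ * ‖W‖)
    (W : ι → ℝ) (i : ι) : |(CFC.sqrt (Ckr D Qk Q ak aL 0) *ᵥ W) i| ≤ c * ‖W‖ := by
  have hM := ckInv_posDef (Qk := Qk) hD hak haL Q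
  have h0 : Ckr D Qk Q ak aL 0 = (Deltak D Qk ak + aL • proj Q)⁻¹ := by
    rw [Ckr_eq_inv_add, zero_smul, add_zero]
  rw [h0]
  exact abs_sqrt_inv_mulVec_le hM (fun r hr W' i' => by rw [← Ckr_eq_inv_add]; exact hc r hr W' i') W i

end SupNorm

/-! ## §6 (v1.2) The input `|A_{k,r}W| ≤ 𝒪(1)(1+r)^{−1}‖W‖_∞` from (three), and LEMMA 16's bound assembled -/

section AkrBound

variable {ι κ σ : Type*} [Fintype ι] [Fintype κ] [Fintype σ] [DecidableEq ι] [DecidableEq κ] [DecidableEq σ]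
variable {D : Matrix κ κ ℝ} {Qk : Matrix ι κ ℝ} {Q : Matrix σ ι ℝ} {ak aL r : ℝ}

/-- `(a_k + r)⁻¹ ≤ max(1, a_k⁻¹)·(1 + r)⁻¹` for `a_k > 0`, `r ≥ 0`: the print's `𝒪(1)(1+r)^{−1}`. [folklore] -/
private theorem inv_add_le_max_mul_inv (hak : 0 < ak) (hr : 0 ≤ r) :
    (ak + r)⁻¹ ≤ max 1 ak⁻¹ * (1 + r)⁻¹ := by
  have h1 : 0 < ak + r := by linarith
  have h1r : 0 < 1 + r := by linarith
  have hprod : 1 + r ≤ max 1 ak⁻¹ * (ak + r) := by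
    rcases le_or_gt 1 ak with hk | hk
    · calc 1 + r ≤ ak + r := by linarith
        _ = 1 * (ak + r) := (one_mul _).symm
        _ ≤ max 1 ak⁻¹ * (ak + r) := mul_le_mul_of_nonneg_right (le_max_left _ _) h1.le
    · have hinv : ak⁻¹ * (ak + r) = 1 + ak⁻¹ * r := by field_simp
      have hi1 : 1 ≤ ak⁻¹ := (one_le_inv₀ hak).2 hk.le
      have hr' : r ≤ ak⁻¹ * r := by nlinarith
      calc 1 + r ≤ 1 + ak⁻¹ * r := by linarith
        _ = ak⁻¹ * (ak + r) := hinv.symm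
        _ ≤ max 1 ak⁻¹ * (ak + r) := mul_le_mul_of_nonneg_right (le_max_right _ _) h1.le
  calc (ak + r)⁻¹ = (1 + r) * ((ak + r)⁻¹ * (1 + r)⁻¹) := by field_simp
    _ ≤ (max 1 ak⁻¹ * (ak + r)) * ((ak + r)⁻¹ * (1 + r)⁻¹) :=
        mul_le_mul_of_nonneg_right hprod (by positivity)
    _ = max 1 ak⁻¹ * (1 + r)⁻¹ := by field_simp

omit [DecidableEq σ] in
/-- **`|A_{k,r}W| ≤ 𝒪(1)(1+r)^{−1}‖W‖_∞`** from (three) `A_{k,r} = (a_k+r)^{−1}(I − QᵀQ) + (a_k + aL^{−2} + r)^{−1}QᵀQ`: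
if the projection `QᵀQ` is a sup-norm contraction (block averaging: `BlockAveragingMatrix.abs_proj_Qmat_mulVec_le`) then
`|(A_{k,r}W)_y| ≤ 2(a_k + r)^{−1}‖W‖_∞ ≤ 2max(1, a_k^{−1})(1 + r)^{−1}‖W‖_∞`. [cite: Dimock2013, §4.2 (three) L2099–2105 and
§4.3 Lemma 11 proof L2204 (arXiv:1108.1335v2 TeX)] -/
theorem abs_Akr_mulVec_le (hak : 0 < ak) (haL : 0 ≤ aL) (hr : 0 ≤ r)
    (hP : ∀ (W : ι → ℝ) (y : ι), |(proj Q *ᵥ W) y| ≤ ‖W‖) (W : ι → ℝ) (y : ι) :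
    |(Akr Q ak aL r *ᵥ W) y| ≤ 2 * max 1 ak⁻¹ * (1 + r)⁻¹ * ‖W‖ := by
  have h1 : 0 < ak + r := by linarith
  have h2 : 0 < ak + aL + r := by linarith
  have hW : |W y| ≤ ‖W‖ := by simpa [Real.norm_eq_abs] using norm_le_pi_norm W y
  have hentry : (Akr Q ak aL r *ᵥ W) y
      = (ak + r)⁻¹ * W y + ((ak + aL + r)⁻¹ - (ak + r)⁻¹) * (proj Q *ᵥ W) y := by
    simp only [Akr, Matrix.add_mulVec, Matrix.smul_mulVec, Matrix.sub_mulVec, Matrix.one_mulVec, Pi.add_apply,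
      Pi.smul_apply, Pi.sub_apply, smul_eq_mul]
    ring
  have hle : (ak + aL + r)⁻¹ ≤ (ak + r)⁻¹ := inv_anti₀ h1 (by linarith)
  have hcoef : |(ak + aL + r)⁻¹ - (ak + r)⁻¹| ≤ (ak + r)⁻¹ := by
    rw [abs_sub_comm, abs_of_nonneg (sub_nonneg.2 hle)]
    linarith [(inv_pos.2 h2).le]
  have hkey := inv_add_le_max_mul_inv hak hr
  calc |(Akr Q ak aL r *ᵥ W) y|
      = |(ak + r)⁻¹ * W y + ((ak + aL + r)⁻¹ - (ak + r)⁻¹) * (proj Q *ᵥ W) y| := by rw [hentry]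
    _ ≤ |(ak + r)⁻¹ * W y| + |((ak + aL + r)⁻¹ - (ak + r)⁻¹) * (proj Q *ᵥ W) y| := abs_add_le _ _
    _ = (ak + r)⁻¹ * |W y| + |(ak + aL + r)⁻¹ - (ak + r)⁻¹| * |(proj Q *ᵥ W) y| := by
        rw [abs_mul, abs_mul, abs_of_pos (inv_pos.2 h1)]
    _ ≤ (ak + r)⁻¹ * ‖W‖ + (ak + r)⁻¹ * ‖W‖ :=
        add_le_add (mul_le_mul_of_nonneg_left hW (inv_pos.2 h1).le)
          (mul_le_mul hcoef (hP W y) (abs_nonneg _) (inv_pos.2 h1).le)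
    _ = 2 * (ak + r)⁻¹ * ‖W‖ := by ring
    _ ≤ 2 * (max 1 ak⁻¹ * (1 + r)⁻¹) * ‖W‖ := by
        refine mul_le_mul_of_nonneg_right ?_ (norm_nonneg _)
        exact mul_le_mul_of_nonneg_left hkey (by norm_num)
    _ = 2 * max 1 ak⁻¹ * (1 + r)⁻¹ * ‖W‖ := by ring

/-- **LEMMA 16's sup-norm bound assembled from its two inputs**: for `D = −Δ + μ̄_k` positive definite, `QQᵀ = I` with
`QᵀQ` a sup-norm contraction, `a_k > 0`, `aL ≥ 0`, and the random-walk input *"|D_{k,r}W| ≤ C‖W‖_∞"* for `D_{k,r} =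
Q_kG_{k,r}Q_kᵀ` uniformly in `r > 0` (App. E — a hypothesis here), one gets `|(C_k^{1/2}W)_i| ≤ c₁(1 + a_k²c₁δ)‖W‖_∞` with
`c₁ = 2max(1, a_k^{−1})` ((two) `Ckr_eq`, §5 `abs_add_sq_smul_mulVec_le`, `abs_sqrt_Ck_mulVec_le`). [cite: Dimock2013, §4.3
Lemma 11 L2187–2191 with proof L2197–2206 (arXiv:1108.1335v2 TeX)] -/
theorem abs_sqrt_Ck_mulVec_le_of_inputs (hD : D.PosDef) (hQ : Q * Qᵀ = 1) (hak : 0 < ak) (haL : 0 ≤ aL)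
    (hP : ∀ (W : ι → ℝ) (y : ι), |(proj Q *ᵥ W) y| ≤ ‖W‖) {δ : ℝ} (hδ : 0 ≤ δ)
    (hDkr : ∀ r : ℝ, 0 < r → ∀ (W : ι → ℝ) (y : ι),
      |((Qk * Gkr D Qk Q ak aL r * Qkᵀ) *ᵥ W) y| ≤ δ * ‖W‖)
    (W : ι → ℝ) (i : ι) :
    |(CFC.sqrt (Ckr D Qk Q ak aL 0) *ᵥ W) i|
      ≤ (2 * max 1 ak⁻¹) * (1 + ak ^ 2 * (2 * max 1 ak⁻¹) * δ) * ‖W‖ := by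
  have hc₁ : 0 ≤ 2 * max 1 ak⁻¹ := by
    have := le_max_left (1 : ℝ) ak⁻¹
    linarith
  refine abs_sqrt_Ck_mulVec_le hD hak haL (fun r hr W' y => ?_) W i
  rw [Ckr_eq hD hQ hak haL hr.le]
  have hassoc : Akr Q ak aL r * Qk * Gkr D Qk Q ak aL r * Qkᵀ * Akr Q ak aL r
      = Akr Q ak aL r * (Qk * Gkr D Qk Q ak aL r * Qkᵀ) * Akr Q ak aL r := by
    simp only [Matrix.mul_assoc]
  rw [hassoc]
  have h := abs_add_sq_smul_mulVec_le (Akr Q ak aL r) (Qk * Gkr D Qk Q ak aL r * Qkᵀ) (a := ak) hc₁ hδ hr.le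
    (fun W'' y'' => abs_Akr_mulVec_le hak haL hr.le hP W'' y'') (hDkr r hr) W' y
  exact h

/-- **… with the block-averaging input DISCHARGED**: for `Q = Qmat b N` of `BlockAveragingMatrix` (the one-step block
averaging in the isometric normalisation — every fibre of the block map `b` has `N > 0` sites, so `QQᵀ = I` by
`Qmat_mul_transpose` and `QᵀQ` is a sup-norm contraction by `abs_proj_Qmat_mulVec_le`), the ONLY remaining input of
*"|C_k^{1/2}W| ≤ C‖W‖_∞"* is the random-walk bound on `D_{k,r} = Q_kG_{k,r}Q_kᵀ` (App. E). [cite: Dimock2013, §4.3 Lemma 11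
L2187–2191 with proof L2197–2206; §2.1 L335–336 (arXiv:1108.1335v2 TeX)] -/
theorem abs_sqrt_Ck_mulVec_le_blockAvg {b : ι → σ} {N : ℕ} (hb : ∀ y, (BlockAveragingMatrix.fibre b y).card = N)
    (hN : 0 < N) (hD : D.PosDef) (hak : 0 < ak) (haL : 0 ≤ aL) {δ : ℝ} (hδ : 0 ≤ δ)
    (hDkr : ∀ r : ℝ, 0 < r → ∀ (W : ι → ℝ) (y : ι),
      |((Qk * Gkr D Qk (BlockAveragingMatrix.Qmat b N) ak aL r * Qkᵀ) *ᵥ W) y| ≤ δ * ‖W‖)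
    (W : ι → ℝ) (i : ι) :
    |(CFC.sqrt (Ckr D Qk (BlockAveragingMatrix.Qmat b N) ak aL 0) *ᵥ W) i|
      ≤ (2 * max 1 ak⁻¹) * (1 + ak ^ 2 * (2 * max 1 ak⁻¹) * δ) * ‖W‖ :=
  abs_sqrt_Ck_mulVec_le_of_inputs hD (BlockAveragingMatrix.Qmat_mul_transpose hb hN) hak haL
    (fun W' y => BlockAveragingMatrix.abs_proj_Qmat_mulVec_le hb hN W' y) hδ hDkr W i

end AkrBound

end Literature.MathematicalPhysics.QuantumFieldTheory.Dimock2011to13.CovarianceSquareRoot
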